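import Summits.Ventures.GridStability.Bench.NE39SPEnergyRoa
import Summits.Ventures.GridStability.Lyapunov.StructurePreservingRateRoa
import Summits.Ventures.GridStability.Models.StructurePreservingPhaseBridge
import HarnessLib

/-!
# GridStability/Bench/NE39SPEnergyRate — «SP-RATE» instance on the rung «G2.b-SP NE39» object: a
# solver-free, closed-form EXPONENTIAL synchronisation rate on the certified region of record
# `{V ≤ 29/10} ∩ window ∩ leaf` of the 49-node structure-preserving New England instance (column LF)

Cell `gridfusion` (LADDER-GRIDFUSION), seat gridfusion-lyap-1 (g7), brief «SP-RATE» (g6's NEXT-WAVE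
PLAN; lead g7 queue). INPUTS BY NAME: the rung file `Bench/NE39SPEnergyRoa.lean` (p481288: the certified
level `29/10 < c⋆(θ, β)`, `roa`), model-2's instance typing `Models/NE39SP.lean` (`params D`, every
hypothesis discharged for every `D > 0`: `wellFormed`, `preconnected`, `edge_lower`, `window`, `θ`, `betaLF`,
`MQ`, `genS`), this seat's generic layer `Lyapunov/StructurePreservingRate{,Roa}.lean` (p544339 + sequel:
`vhRate`, `vhGain`, `phaseEnergy_le_mul_exp_neg_of_sublevel`).

WHAT IS PROVED. For EVERY damping / load-frequency vector `D > 0` (UNPRINTED for this system — the data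
carry the token «D(∀)») and every cross-term weight `0 < h` with `2h·Mᵢ ≤ Dᵢ` on the ten internal nodes:
* `energy_le_mul_exp_neg` — along EVERY global solution `X` of the structure-preserving field from the
  certified region of record `S = {V(δ₀; δ, ω) ≤ 29/10} ∩ {|δᵢ − δⱼ| < π/2 on coupled pairs} ∩
  {L(δ, ω) = L(δ₀, 0), ω_bus = 0}`, for all `t ≥ 0`:
  `V(X t) ≤ 3·vhGain·V(X 0)·exp(−vhRate·t)` with the generic closed forms evaluated at the instance;
* `sum_gen_M` (`Σ_gen M = 7827/1885`), `half_le_sectorGain` (`g(θ) ≥ 1/2`, from `sin θ = 2τ/(1 + τ²)`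
  exactly, `sin θ ≤ θ` and `π < 3.1416`), hence the EXPLICIT RATIONAL FUNCTIONS of `(ΣD, h)`:
  `vhRate_ge` — `vhRate ≥ ρ_lo(ΣD, h) = min{ h/(1 + (7827/1885)·h/ΣD), h/(1 + 9604·h·ΣD/β) }`,
  `β = betaLF = 5200202273/312500000`; `vhGain_le` — `vhGain ≤ C_hi(ΣD, h) = max{2 + 2·(7827/1885)·h/ΣD,
  2·(1 + 9604·h·ΣD/β)}`;
* `energy_le_mul_exp_neg_explicit` — the sentence with the explicit `ρ_lo`, `C_hi`.

THREE COLUMNS. CERTIFIED (kernel, here): the inequalities above for MODEL M′ = MV-3 at the NE39-SP data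
of record (column LF), every `D > 0`. MODELLED: tokens of model-2's file («MV-3 + lossless + MV-P + D(∀) +
ω_s declared + V-frozen(LF) + |E|′(h12)»). HONEST NUMBER (VALIDATED-type commentary, not a certificate):
`ρ_lo` is a LOWER bound on the model's exponential rate inside `S`; the `n² = 2401` walk constant of the
leaf Poincaré bound dominates it — for an illustrative uniform `Dᵢ = d` the best `h` gives
`ρ_lo ≈ 3.6·10⁻⁵/d s⁻¹`, i.e. the theorem certifies «exponential, with SOME explicit rate», not a useful
damping time; modal damping of the New England system is a different (VALIDATED) quantity. No sentence
of this file says that the New England system or any grid is stable or well damped. No definition, no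
named fact; standard axioms.
-/

noncomputable section

open Set Filter Topology Real Finset
open Summit.Ventures.GridStability.Models
open Summit.Ventures.GridStability.Models.StructurePreserving
open Summit.Ventures.GridStability.Models.NE39SP
open Summit.Ventures.GridStability.Lyapunov.StructurePreserving (vhRate vhGain vhRate_pos
  two_le_vhGain phaseEnergy_le_mul_exp_neg_of_sublevel sin_two_mul_arctan)

namespace Summit.Ventures.GridStability.Bench.NE39SP

/-! ### Instance constants -/

/-- **`Σ_gen M = 7827/1885`** (the ten internal-node inertias `2Hᵢ/ω_s` of model-2's `MQ`). CERTIFIED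
(exact rational arithmetic). [cite: Padiyar2013, App. D] -/
theorem sum_gen_M (D : Fin 49 → ℝ) : ∑ i ∈ (params D).gen, (params D).M i = (7827 / 1885 : ℝ) := by
  change ∑ i ∈ genS, ((MQ i : ℚ) : ℝ) = _
  rw [← Rat.cast_sum]
  have h : ∑ i ∈ genS, MQ i = 7827 / 1885 := by
    simp [genS, MQ]
    norm_num
  rw [h]
  norm_num

/-- **`g(θ) ≥ 1/2`** for the window level `θ = 2·arctan τ_max` of column LF (`g(θ) = (1 − sin θ)/(π/2 − θ)
≈ 0.5196`): `sin θ = 2τ/(1 + τ²)` exactly, `sin θ ≤ θ`, `π < 3.1416` and the rational check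
`2τ/(1 + τ²) ≤ 2 − 1.5708`. CERTIFIED. [folklore] -/
theorem half_le_sectorGain : (1 / 2 : ℝ) ≤ (1 - Real.sin θ) / (π / 2 - θ) := by
  have hsin : Real.sin θ = 2 * (tauLF : ℝ) / (1 + (tauLF : ℝ) ^ 2) := by
    unfold NE39SP.θ
    exact sin_two_mul_arctan _
  have hθ0 := theta_nonneg
  have hθ := theta_lt_pi_div_two
  have hθsin : Real.sin θ ≤ θ := Real.sin_le hθ0
  have hden : 0 < π / 2 - θ := by linarith
  have hs : 2 * (tauLF : ℝ) / (1 + (tauLF : ℝ) ^ 2) ≤ 2 - 1.5708 := by norm_num [tauLF]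
  have hpi : π < 3.1416 := Real.pi_lt_d4
  rw [le_div_iff₀ hden]
  rw [hsin] at hθsin ⊢
  linarith

/-! ### The rate theorem on the certified region of record -/

/-- **«SP-RATE» on rung «G2.b-SP NE39» — exponential decay of the energy of record.** MODEL MV-3 at the
NE39-SP instance of record (column LF), for EVERY damping / load-frequency vector `D > 0` and every
cross-term weight `0 < h` with `2h·Mᵢ ≤ Dᵢ` on the internal nodes: along EVERY global solution `X` of the
structure-preserving field whose initial phase point lies in the certified region of record
`S = {V(δ₀; δ, ω) ≤ 29/10} ∩ window ∩ {L = L(δ₀, 0), ω_bus = 0}` (the set of `roa`, p481288), for all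
`t ≥ 0`: `V(X t) ≤ 3·vhGain·V(X 0)·exp(−vhRate·t)` — one call of the generic
`phaseEnergy_le_mul_exp_neg_of_sublevel` at the certified level `level_lt_levelBound`. CERTIFIED for
MODEL M′ only; no sentence here says a grid is stable or well damped.
[cite: Khalil2002, Theorem 4.10]; [cite: Padiyar2013, §3.2 eq (3.11), App. D] -/
theorem energy_le_mul_exp_neg {D : Fin 49 → ℝ} (hD : ∀ i, 0 < D i) {h : ℝ} (hh : 0 < h)
    (hhM : ∀ i ∈ genS, 2 * h * (MQ i : ℝ) ≤ D i)
    {X : ℝ → (Fin 49 → ℝ) × (Fin 49 → ℝ)}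
    (hX0 : X 0 ∈ (params D).window ∩ (params D).constraintSet δ₀ ∧
      (params D).energy δ₀ (X 0).1 (X 0).2 ≤ 29 / 10)
    (hX : ∀ T : ℝ, ∀ s ∈ Icc 0 T,
      HasDerivWithinAt X ((params D).shifted.phaseField (X s)) (Icc 0 T) s)
    {t : ℝ} (ht : 0 ≤ t) :
    (params D).energy δ₀ (X t).1 (X t).2
      ≤ 3 * vhGain (params D) (betaLF : ℝ) θ h * (params D).energy δ₀ (X 0).1 (X 0).2
        * Real.exp (-vhRate (params D) (betaLF : ℝ) θ h * t) := by
  have hhM' : ∀ i ∈ (params D).gen, 2 * h * (params D).M i ≤ (params D).D i := hhM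
  have hX0' : X 0 ∈ Lyapunov.StructurePreserving.window (params D)
      ∩ Lyapunov.StructurePreserving.constraintSet (params D) δ₀ ∧
      Lyapunov.StructurePreserving.phaseEnergy (params D) δ₀ (X 0) ≤ 29 / 10 := by
    rw [(params D).lyapunov_window_eq, (params D).lyapunov_constraintSet_eq]
    exact hX0
  have hX' : ∀ T : ℝ, ∀ s ∈ Icc 0 T, HasDerivWithinAt X
      (Lyapunov.StructurePreserving.phaseField (params D) (X s)) (Icc 0 T) s := by
    rw [(params D).lyapunov_phaseField_eq]
    exact hX
  exact phaseEnergy_le_mul_exp_neg_of_sublevel (wellFormed hD) (by decide) (preconnected D)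
    (fun i j => by rw [params_b]; exact b_nonneg i j) beta_pos (edge_lower D) theta_nonneg
    theta_lt_pi_div_two (window D) (isSyncEquilibrium D) level_lt_levelBound hh hhM' hX0' hX' ht

/-! ### The explicit rational bounds in `(ΣD, h)` -/

/-- **Explicit lower bound of the rate**: for every `D > 0` and `h > 0`,
`vhRate ≥ ρ_lo(ΣD, h) = min{ h/(1 + (7827/1885)·h/ΣD), h/(1 + 9604·h·ΣD/β) }` (`Σ_gen M = 7827/1885`,
`n² = 2401`, `2·g(θ) ≥ 1`). CERTIFIED. [folklore] -/
theorem vhRate_ge {D : Fin 49 → ℝ} (hD : ∀ i, 0 < D i) {h : ℝ} (hh : 0 < h) :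
    min (h / (1 + (7827 / 1885) * h / ∑ i, D i)) (h / (1 + 9604 * h * (∑ i, D i) / (betaLF : ℝ)))
      ≤ vhRate (params D) (betaLF : ℝ) θ h := by
  have hSD : 0 < ∑ i, D i := Finset.sum_pos (fun i _ => hD i) Finset.univ_nonempty
  have hβ : (0 : ℝ) < (betaLF : ℝ) := beta_pos
  have hg := half_le_sectorGain
  unfold vhRate
  rw [sum_gen_M D]
  change min _ _ ≤ min (h / (1 + h * (7827 / 1885) / ∑ i, D i))
    (2 * h * ((1 - Real.sin θ) / (π / 2 - θ)) / (1 + 4 * h * ((49 : ℕ) : ℝ) ^ 2 * (∑ i, D i) / betaLF))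
  refine min_le_min (le_of_eq ?_) ?_
  · ring_nf
  · have hden : 0 < 1 + 9604 * h * (∑ i, D i) / (betaLF : ℝ) := by positivity
    have hdeq : (1 + 4 * h * ((49 : ℕ) : ℝ) ^ 2 * (∑ i, D i) / (betaLF : ℝ))
        = 1 + 9604 * h * (∑ i, D i) / (betaLF : ℝ) := by
      push_cast
      ring
    rw [hdeq]
    exact div_le_div_of_nonneg_right (by nlinarith) hden.le

/-- **Explicit upper bound of the gain**: `vhGain ≤ C_hi(ΣD, h) = max{2 + 2·(7827/1885)·h/ΣD,
2·(1 + 9604·h·ΣD/β)}` (`1/g(θ) ≤ 2`). CERTIFIED. [folklore] -/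
theorem vhGain_le {D : Fin 49 → ℝ} (hD : ∀ i, 0 < D i) {h : ℝ} (hh : 0 < h) :
    vhGain (params D) (betaLF : ℝ) θ h
      ≤ max (2 + 2 * (7827 / 1885) * h / ∑ i, D i) (2 * (1 + 9604 * h * (∑ i, D i) / (betaLF : ℝ))) := by
  have hSD : 0 < ∑ i, D i := Finset.sum_pos (fun i _ => hD i) Finset.univ_nonempty
  have hβ : (0 : ℝ) < (betaLF : ℝ) := beta_pos
  have hg := half_le_sectorGain
  have hgpos : 0 < (1 - Real.sin θ) / (π / 2 - θ) := lt_of_lt_of_le (by norm_num) hg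
  unfold vhGain
  rw [sum_gen_M D]
  change max (2 + 2 * h * (7827 / 1885) / ∑ i, D i)
    ((1 + 4 * h * ((49 : ℕ) : ℝ) ^ 2 * (∑ i, D i) / betaLF) / ((1 - Real.sin θ) / (π / 2 - θ))) ≤ _
  refine max_le_max (le_of_eq ?_) ?_
  · ring_nf
  · have hdeq : (1 + 4 * h * ((49 : ℕ) : ℝ) ^ 2 * (∑ i, D i) / (betaLF : ℝ))
        = 1 + 9604 * h * (∑ i, D i) / (betaLF : ℝ) := by
      push_cast
      ring
    rw [hdeq]
    have hA : 0 ≤ 1 + 9604 * h * (∑ i, D i) / (betaLF : ℝ) := by positivity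
    rw [div_le_iff₀ hgpos]
    nlinarith

/-- **The «SP-RATE» sentence with explicit constants.** For EVERY `D > 0` and every `0 < h` with
`2h·Mᵢ ≤ Dᵢ` on the internal nodes, along EVERY global solution `X` of the structure-preserving field
of the NE39-SP instance of record from `S = {V ≤ 29/10} ∩ window ∩ leaf`, for all `t ≥ 0`:
`V(X t) ≤ 3·C_hi(ΣD, h)·V(X 0)·exp(−ρ_lo(ΣD, h)·t)`,
`ρ_lo = min{h/(1 + (7827/1885)h/ΣD), h/(1 + 9604·h·ΣD/β)}`, `C_hi = max{2 + 2(7827/1885)h/ΣD,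
2(1 + 9604·h·ΣD/β)}`, `β = 5200202273/312500000` — rational functions of the (unprinted) total damping
`ΣD` and the free weight `h`, no solver, no matrix inverse. CERTIFIED for MODEL M′ = MV-3 at the data of
record; a LOWER bound on the model's rate, small because of the `n² = 2401` walk constant; no sentence
here says a grid is stable or well damped. [cite: Khalil2002, Theorem 4.10]; [cite: Padiyar2013, App. D] -/
theorem energy_le_mul_exp_neg_explicit {D : Fin 49 → ℝ} (hD : ∀ i, 0 < D i) {h : ℝ} (hh : 0 < h)
    (hhM : ∀ i ∈ genS, 2 * h * (MQ i : ℝ) ≤ D i)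
    {X : ℝ → (Fin 49 → ℝ) × (Fin 49 → ℝ)}
    (hX0 : X 0 ∈ (params D).window ∩ (params D).constraintSet δ₀ ∧
      (params D).energy δ₀ (X 0).1 (X 0).2 ≤ 29 / 10)
    (hX : ∀ T : ℝ, ∀ s ∈ Icc 0 T,
      HasDerivWithinAt X ((params D).shifted.phaseField (X s)) (Icc 0 T) s)
    {t : ℝ} (ht : 0 ≤ t) :
    (params D).energy δ₀ (X t).1 (X t).2
      ≤ 3 * max (2 + 2 * (7827 / 1885) * h / ∑ i, D i) (2 * (1 + 9604 * h * (∑ i, D i) / (betaLF : ℝ)))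
        * (params D).energy δ₀ (X 0).1 (X 0).2
        * Real.exp (-min (h / (1 + (7827 / 1885) * h / ∑ i, D i))
            (h / (1 + 9604 * h * (∑ i, D i) / (betaLF : ℝ))) * t) := by
  have hmain := energy_le_mul_exp_neg hD hh hhM hX0 hX ht
  have hρ := vhRate_ge hD hh
  have hC := vhGain_le hD hh
  -- the energy at `X 0` is nonnegative (window: `W ≥ 0`)
  have hV0 : 0 ≤ (params D).energy δ₀ (X 0).1 (X 0).2 := by
    have hw := hX0.1.1
    refine (params D).energy_nonneg (wellFormed hD) (fun i j => by rw [params_b]; exact b_nonneg i j)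
      (fun i j hij => ((window D) i j hij).trans theta_lt_pi_div_two.le) ?_ _
    intro i j hij
    have h1 := abs_lt.1 (hw i j hij)
    have h2 := abs_le.1 (((window D) i j hij).trans theta_lt_pi_div_two.le)
    exact abs_le.2 ⟨by linarith [h1.1, h2.1], by linarith [h1.2, h2.2]⟩
  have hexp : Real.exp (-vhRate (params D) (betaLF : ℝ) θ h * t)
      ≤ Real.exp (-min (h / (1 + (7827 / 1885) * h / ∑ i, D i))
            (h / (1 + 9604 * h * (∑ i, D i) / (betaLF : ℝ))) * t) :=
    Real.exp_le_exp.2 (by nlinarith)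
  have hexp0 : 0 ≤ Real.exp (-vhRate (params D) (betaLF : ℝ) θ h * t) := (Real.exp_pos _).le
  have hG0 : 0 ≤ vhGain (params D) (betaLF : ℝ) θ h :=
    le_trans (by norm_num) (two_le_vhGain (wellFormed hD) (by decide) hh.le)
  calc (params D).energy δ₀ (X t).1 (X t).2
      ≤ 3 * vhGain (params D) (betaLF : ℝ) θ h * (params D).energy δ₀ (X 0).1 (X 0).2
          * Real.exp (-vhRate (params D) (betaLF : ℝ) θ h * t) := hmain
    _ ≤ 3 * max (2 + 2 * (7827 / 1885) * h / ∑ i, D i)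
            (2 * (1 + 9604 * h * (∑ i, D i) / (betaLF : ℝ)))
          * (params D).energy δ₀ (X 0).1 (X 0).2
          * Real.exp (-vhRate (params D) (betaLF : ℝ) θ h * t) := by
        have := mul_le_mul_of_nonneg_right (mul_le_mul_of_nonneg_right hC hV0) hexp0
        linarith
    _ ≤ 3 * max (2 + 2 * (7827 / 1885) * h / ∑ i, D i)
            (2 * (1 + 9604 * h * (∑ i, D i) / (betaLF : ℝ)))
          * (params D).energy δ₀ (X 0).1 (X 0).2
          * Real.exp (-min (h / (1 + (7827 / 1885) * h / ∑ i, D i))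
              (h / (1 + 9604 * h * (∑ i, D i) / (betaLF : ℝ))) * t) := by
        have hpre : 0 ≤ 3 * max (2 + 2 * (7827 / 1885) * h / ∑ i, D i)
            (2 * (1 + 9604 * h * (∑ i, D i) / (betaLF : ℝ)))
            * (params D).energy δ₀ (X 0).1 (X 0).2 :=
          mul_nonneg (mul_nonneg (by norm_num) (le_trans hG0 hC)) hV0
        exact mul_le_mul_of_nonneg_left hexp hpre

end Summit.Ventures.GridStability.Bench.NE39SP

end
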